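import Summits.ValiantsHypothesis.ValiantsHypothesis.Theorems.GrenetZeonTwoDimCoefficientsDualUnipotentTriangularisable
import Summits.ValiantsHypothesis.ValiantsHypothesis.Theorems.GrenetZeonDualUnipotentThreeHalvesLongMassNilSpaceEngelCriterion

/-!
# Crux `GrenetZeon.TwoDimCoefficients` (stmt-ValiantsHypothesis-8062), stub `stub_dualUnipotent`: THE ENGEL / WORD RUNG `m ≳ n^{3/2}`
# — the triangularisable rung with an INTRINSIC hypothesis on the value space of the nilpotent pencil

The best rung below the open stub `stub_dualUnipotent : DualUnipotentBound` (`n² ≤ C·m`) is the TRIANGULARISABLE RUNG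
(✓ `sq_le_of_trace_pow_mul_triangularisable`, `…DualUnipotentTriangularisable`): if `per_n = tr(N^d·M)` with affine `m × m` pencils and ONE
constant `P` makes `P⁻¹·N·P` strictly upper triangular, then `n² ≤ 2kn + m·q` (`q ≥ 1`, `m ≤ kq`), i.e. `m ≳ n^{3/2}/(2√2)`.  The located open
point is «WILD (non-triangularisable) nilpotent pencils».  This file makes the frontier INTRINSIC, by name, through the dictionary landed for the
sister stub (c) (✓ `NilSpaceEngel.conj_strictUpper_iff_words_eq_zero`, ✓ `conj_strictUpper_iff_exists_lieClosed_nil`, ✓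
`exists_unit_conj_strictUpper_of_lieClosed`):

* ★ `sq_le_of_trace_pow_mul_valueSpace_conj` — the rung from a unit `u` conjugating a space `V ∋ N(x)` (all `x`) into the strictly upper
  triangular matrices (values ⇒ polynomial identity by `MvPolynomial.funext`);
* ★★ `sq_le_of_trace_pow_mul_words_eq_zero` — WORD RUNG: the values of `N` lie in a space `V ≤ M_m(ℂ)` ALL OF WHOSE WORDS OF LENGTH `m` VANISH
  (nil associative envelope) ⇒ `n² ≤ 2kn + m·q`;
* ★★ `sq_le_of_trace_pow_mul_lieClosed` — ENGEL RUNG: the values lie in a Lie-closed space of nilpotent matrices ⇒ the same;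
  `sq_le_of_trace_pow_mul_le_lieClosed_nil` (inside a nil Lie-closed space), `…_commute` (pairwise commuting nilpotent values).
So `stub_dualUnipotent`'s open core is, intrinsically: nilpotent pencils `N` with `per_n = tr(N^{n−1} M)` whose value space has a NON-VANISHING
word of length `m` (equivalently generates a non-nil Lie algebra).

HONEST FRAMING.  Bookkeeping rung for an ASIDE item (`--supports stmt-ValiantsHypothesis-8062`); the stub `stub_dualUnipotent` (`n² ≤ C·m`,
open-problem grade), the crux 8062 and `VP ≠ VNP` are NOT proved or moved.  Def-free, no named-fact hypotheses, no sorry.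
[cite: HornJohnson2013, Thm. 2.4.8.7 (p0162)]
-/

set_option linter.dupNamespace false
set_option autoImplicit false

noncomputable section

namespace Summit.ValiantsHypothesis.ValiantsHypothesis.Theorems.GrenetZeon.DualUnipotentEngelRung

open MvPolynomial Matrix
open Literature.Computability.AlgebraicComplexity
open Summit.ValiantsHypothesis.ValiantsHypothesis.Cruxes.TwoDimCoefficients.DimTwoCases (sq_le_of_trace_pow_mul_triangularisable)
open Summit.ValiantsHypothesis.ValiantsHypothesis.Theorems.GrenetZeon.NilSpaceEngel
  (exists_unit_conj_strictUpper_of_lieClosed exists_unit_conj_strictUpper_of_words_eq_zero exists_unit_conj_strictUpper_of_commute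
    conj_strictUpper_iff_exists_lieClosed_nil)

variable {n m : ℕ}

/-- ★ **The rung from a conjugating unit on the value space.**  If `per_n = tr(N^d·M)` with affine `m × m` pencils, every value `N(x)` lies in
`V ≤ M_m(ℂ)`, and one unit `u` makes every `u A u⁻¹` (`A ∈ V`) strictly upper triangular, then `n² ≤ 2kn + m·q` for all `q ≥ 1`, `m ≤ kq`.
[folklore] -/
theorem sq_le_of_trace_pow_mul_valueSpace_conj {d q k : ℕ}
    (N M : Matrix (Fin m) (Fin m) (MvPolynomial (Fin n × Fin n) ℂ))
    (hN : ∀ i j, (N i j).totalDegree ≤ 1) (hM : ∀ i j, (M i j).totalDegree ≤ 1)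
    (V : Submodule ℂ (Matrix (Fin m) (Fin m) ℂ)) (hV : ∀ x : Fin n × Fin n → ℂ, N.map (MvPolynomial.eval x) ∈ V)
    (u : (Matrix (Fin m) (Fin m) ℂ)ˣ)
    (hu : ∀ A ∈ V, ∀ i j : Fin m, j ≤ i → ((u : Matrix (Fin m) (Fin m) ℂ) * A * (↑u⁻¹ : Matrix (Fin m) (Fin m) ℂ)) i j = 0)
    (hper : perPoly (Fin n) ℂ = (N ^ d * M).trace) (hq : 1 ≤ q) (hmk : m ≤ k * q) :
    n ^ 2 ≤ k * (2 * n) + m * q := by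
  -- `P := u⁻¹`, so that `P⁻¹ = u`
  set P : Matrix (Fin m) (Fin m) ℂ := ((u⁻¹ : (Matrix (Fin m) (Fin m) ℂ)ˣ) : Matrix (Fin m) (Fin m) ℂ) with hP
  have hPunit : IsUnit P := ⟨u⁻¹, rfl⟩
  have hPdet : IsUnit P.det := (Matrix.isUnit_iff_isUnit_det P).mp hPunit
  have hPinv : P⁻¹ = (u : Matrix (Fin m) (Fin m) ℂ) := by
    rw [hP, ← Matrix.coe_units_inv, inv_inv]
  refine sq_le_of_trace_pow_mul_triangularisable N M hN hM P hPdet (fun i j hji => ?_) hper hq hmk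
  apply MvPolynomial.funext
  intro x
  have h1 : MvPolynomial.eval x (((P⁻¹.map C : Matrix (Fin m) (Fin m) (MvPolynomial (Fin n × Fin n) ℂ)) * N *
      (P.map C : Matrix (Fin m) (Fin m) (MvPolynomial (Fin n × Fin n) ℂ))) i j) =
      (P⁻¹ * N.map (MvPolynomial.eval x) * P) i j := by
    have hPC : ((P.map C : Matrix (Fin m) (Fin m) (MvPolynomial (Fin n × Fin n) ℂ))).map (MvPolynomial.eval x) = P := by
      rw [Matrix.map_map]; ext a c; simp
    have hQC : ((P⁻¹.map C : Matrix (Fin m) (Fin m) (MvPolynomial (Fin n × Fin n) ℂ))).map (MvPolynomial.eval x) = P⁻¹ := by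
      rw [Matrix.map_map]; ext a c; simp
    rw [← Matrix.map_apply (f := MvPolynomial.eval x), Matrix.map_mul, Matrix.map_mul, hPC, hQC]
  rw [h1, map_zero, hPinv, hP]
  exact hu _ (hV x) i j hji

/-- ★★ **WORD RUNG.**  If `per_n = tr(N^d·M)` (affine `m × m` pencils) and the values of `N` lie in a space `V ≤ M_m(ℂ)` all of whose words of
some length `s` vanish (nil associative envelope — e.g. `s = m`), then `n² ≤ 2kn + m·q` for all `q ≥ 1`, `m ≤ kq`: the rung `m ≳ n^{3/2}/(2√2)`.
[folklore] -/
theorem sq_le_of_trace_pow_mul_words_eq_zero {d q k s : ℕ}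
    (N M : Matrix (Fin m) (Fin m) (MvPolynomial (Fin n × Fin n) ℂ))
    (hN : ∀ i j, (N i j).totalDegree ≤ 1) (hM : ∀ i j, (M i j).totalDegree ≤ 1)
    (V : Submodule ℂ (Matrix (Fin m) (Fin m) ℂ)) (hV : ∀ x : Fin n × Fin n → ℂ, N.map (MvPolynomial.eval x) ∈ V)
    (hwords : ∀ w : Fin s → Matrix (Fin m) (Fin m) ℂ, (∀ t, w t ∈ V) → (List.ofFn w).prod = 0)
    (hper : perPoly (Fin n) ℂ = (N ^ d * M).trace) (hq : 1 ≤ q) (hmk : m ≤ k * q) :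
    n ^ 2 ≤ k * (2 * n) + m * q := by
  obtain ⟨u, hu⟩ := exists_unit_conj_strictUpper_of_words_eq_zero V hwords
  exact sq_le_of_trace_pow_mul_valueSpace_conj N M hN hM V hV u hu hper hq hmk

/-- ★★ **ENGEL RUNG.**  If `per_n = tr(N^d·M)` (affine `m × m` pencils) and the values of `N` lie in a LIE-CLOSED space of nilpotent matrices,
then `n² ≤ 2kn + m·q` for all `q ≥ 1`, `m ≤ kq`. [cite: HornJohnson2013, Thm. 2.4.8.7 (p0162)] -/
theorem sq_le_of_trace_pow_mul_lieClosed {d q k : ℕ}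
    (N M : Matrix (Fin m) (Fin m) (MvPolynomial (Fin n × Fin n) ℂ))
    (hN : ∀ i j, (N i j).totalDegree ≤ 1) (hM : ∀ i j, (M i j).totalDegree ≤ 1)
    (V : Submodule ℂ (Matrix (Fin m) (Fin m) ℂ)) (hV : ∀ x : Fin n × Fin n → ℂ, N.map (MvPolynomial.eval x) ∈ V)
    (hnil : ∀ A ∈ V, IsNilpotent A) (hlie : ∀ A ∈ V, ∀ B ∈ V, A * B - B * A ∈ V)
    (hper : perPoly (Fin n) ℂ = (N ^ d * M).trace) (hq : 1 ≤ q) (hmk : m ≤ k * q) :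
    n ^ 2 ≤ k * (2 * n) + m * q := by
  obtain ⟨u, hu⟩ := exists_unit_conj_strictUpper_of_lieClosed V hnil hlie
  exact sq_le_of_trace_pow_mul_valueSpace_conj N M hN hM V hV u hu hper hq hmk

/-- **ENGEL RUNG, envelope form**: values inside ANY nil Lie-closed space `K ⊇ V`. [folklore] -/
theorem sq_le_of_trace_pow_mul_le_lieClosed_nil {d q k : ℕ}
    (N M : Matrix (Fin m) (Fin m) (MvPolynomial (Fin n × Fin n) ℂ))
    (hN : ∀ i j, (N i j).totalDegree ≤ 1) (hM : ∀ i j, (M i j).totalDegree ≤ 1)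
    (V K : Submodule ℂ (Matrix (Fin m) (Fin m) ℂ)) (hV : ∀ x : Fin n × Fin n → ℂ, N.map (MvPolynomial.eval x) ∈ V) (hVK : V ≤ K)
    (hlie : ∀ A ∈ K, ∀ B ∈ K, A * B - B * A ∈ K) (hnil : ∀ A ∈ K, IsNilpotent A)
    (hper : perPoly (Fin n) ℂ = (N ^ d * M).trace) (hq : 1 ≤ q) (hmk : m ≤ k * q) :
    n ^ 2 ≤ k * (2 * n) + m * q := by
  obtain ⟨u, hu⟩ := (conj_strictUpper_iff_exists_lieClosed_nil V).mpr ⟨K, hVK, hlie, hnil⟩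
  exact sq_le_of_trace_pow_mul_valueSpace_conj N M hN hM V hV u hu hper hq hmk

/-- **COMMUTATIVE RUNG**: pairwise commuting nilpotent values. [folklore] -/
theorem sq_le_of_trace_pow_mul_commute {d q k : ℕ}
    (N M : Matrix (Fin m) (Fin m) (MvPolynomial (Fin n × Fin n) ℂ))
    (hN : ∀ i j, (N i j).totalDegree ≤ 1) (hM : ∀ i j, (M i j).totalDegree ≤ 1)
    (V : Submodule ℂ (Matrix (Fin m) (Fin m) ℂ)) (hV : ∀ x : Fin n × Fin n → ℂ, N.map (MvPolynomial.eval x) ∈ V)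
    (hnil : ∀ A ∈ V, IsNilpotent A) (hcomm : ∀ A ∈ V, ∀ B ∈ V, A * B = B * A)
    (hper : perPoly (Fin n) ℂ = (N ^ d * M).trace) (hq : 1 ≤ q) (hmk : m ≤ k * q) :
    n ^ 2 ≤ k * (2 * n) + m * q := by
  obtain ⟨u, hu⟩ := exists_unit_conj_strictUpper_of_commute V hnil hcomm
  exact sq_le_of_trace_pow_mul_valueSpace_conj N M hN hM V hV u hu hper hq hmk

end Summit.ValiantsHypothesis.ValiantsHypothesis.Theorems.GrenetZeon.DualUnipotentEngelRung

end
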